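import Literature.NumberTheory.NumberFields.SplitPrimesDisjointness
import Literature.NumberTheory.NumberFields.UnramifiedCompositum
import Literature.NumberTheory.GaloisRepresentations.DecomposedGenericOfQuadratic
import HarnessLib

/-!
# `V`-split extensions leave the image of a Galois representation unchanged: absolute form

Topic `NumberTheory/NumberFields` (vocabulary: the tree's `splitPrimes M N` — primes of `M`
splitting completely in `N`, `FrobeniusDensityTheorem.lean` —, `Field.absoluteGaloisGroup F = Γ_F`
acting on `F̄ = AlgebraicClosure F` with `IntermediateField.fixingSubgroup E = Γ_E` for
`E ⊆ F̄`, the restriction `absGaloisRestrict F E : Γ_E → Γ_F` for an abstract extension `E/F`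
(`AbsGaloisGroup.lean`), primes `𝔓 ∈ v.primesAbove` of `\bar ℤ_F` and their inertia groups
`𝔓.inertia Γ_F` (`IntegralGaloisAction.lean`), `absGaloisGroupAdjoinRootsOfUnity F p = Γ_{F(ζ_p)}`
(`DecomposedGeneric.lean`)).  Theorem-only file (no definition, no named fact, D-0026); the
analytic input is the tree's proved Bauer–Chebotarev existence theorem, through the finite-level
file `SplitPrimesDisjointness.lean`, which this file lifts to the absolute Galois group.

The occurrence formalised is the "avoidance" step in the proof of the Fontaine–Laffaille
automorphy lifting theorem of Allen–Calegari–Caraiani–Gee–Helm–Le Hung–Newton–Scholze–Taylor–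
Thorne, *Potential automorphy over CM fields*, Ann. of Math. 197 (2023), Thm. 6.1.1 (§6.5.12,
arXiv:1812.09999 p. 88):

> Let `K/F(ζ_p)` be the extension cut out by `ρ̄|_{G_{F(ζ_p)}}`. Choose finite sets `V₀, V₁, V₂`
> of finite places of `F` having the following properties: for each `v ∈ V₀`, `v` splits in
> `F(ζ_p)`; for each proper subfield `K/K'/F(ζ_p)`, there exists `v ∈ V₀` such that `v` splits in
> `F(ζ_p)` but does not split in `K'`.  For each proper subfield `K/K'/F`, there exists `v ∈ V₁`
> which does not split in `K'`. […] Note that if `E/F` is any finite Galois extension which is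
> `V₀ ∪ V₁ ∪ V₂`-split, then […] `E ∩ K = F`. […] In particular, `E` is linearly disjoint from
> `K`, and therefore `ρ̄(G_E) = ρ̄(G_F)` and `ρ̄(G_{E(ζ_p)}) = ρ̄(G_{F(ζ_p)})`.

(`V₂`, which controls the prime-to-`p` torsion of the class group of `E`, is not treated here.)
The finite-level file proves this inside a fixed finite Galois `L/F`; here `ρ̄` is any
homomorphism `τ : Γ_F → H` with open kernel, `Γ_{F(ζ_p)}` is any open normal subgroup `C ≤ Γ_F`,
and `E` ranges over ALL finite Galois subextensions of `F̄` (resp. all finite Galois `F`-algebras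
`E`), the set `V` being chosen BEFORE `E` — the form in which the printed proof uses it (the
soluble CM extension `E₀/F` is constructed afterwards, `V`-split).

* §1 `splitPrimes_subset_of_isScalarTower`, `splitPrimes_congr`, `splitPrimes_subset_of_le`,
  `mem_splitPrimes_sup_of_isGalois` — complete splitting descends along towers `M ⊆ N ⊆ N'`
  (Mathlib `Algebra.IsUnramifiedAt.of_liesOver`, `Ideal.inertiaDeg_tower`), is invariant under
  `M`-isomorphisms, and ascends to composita of finite Galois subfields of `F̄`.
* §2 `map_fixingSubgroup_eq_range_of_inf_fixedField_ker_eq_bot`,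
  `map_fixingSubgroup_inf_eq_of_sup_inf_fixedField_eq`,
  `fixingSubgroup_sup_eq_top_of_inf_fixedField_eq_bot` — **images via Krull's Galois
  correspondence for open subgroups**: `E ∩ F̄^{ker τ} = F ⟹ τ(Γ_E) = τ(Γ_F)`;
  `E F₁ ∩ F̄^{ker τ ∩ C} = F₁ ⟹ τ(Γ_E ∩ C) = τ(C)` (`F₁ = F̄^C`); and the master form
  `E ∩ F̄^N = F ⟹ Γ_E · N = Γ_F` (any `N`), unpacked by `forall_exists_mem_of_sup_ker_inf_eq_top`
  for `N = ker τ ∩ C`: representatives `e ∈ Γ_E` with `τ e = τ σ`, `e ∈ C ↔ σ ∈ C`.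
* §3 `exists_finset_forall_splitPrimes_map_fixingSubgroup_eq` — **the printed statement**:
  there is a finite `V` (outside any finite `S`, degree-one places, inertia inside `ker τ ∩ C`)
  such that every finite Galois `E ⊆ F̄` that is `V`-split has `τ(Γ_E) = τ(Γ_F)` and
  `τ(Γ_E ∩ C) = τ(C)` (printed route: `V = V₁ ∪ V₀`);
  `exists_finset_forall_splitPrimes_fixingSubgroup_sup_eq_top` — the master form
  `Γ_E · (ker τ ∩ C) = Γ_F` for every finite `V`-split `E ⊆ F̄`, Galois or not (`V = V₁` alone).
* §4 abstract `E/F` through `res : Γ_E → Γ_F`: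
  `exists_finset_forall_splitPrimes_map_range_absGaloisRestrict_eq`,
  `exists_finset_forall_splitPrimes_range_absGaloisRestrict_sup_eq_top`, and, in the vocabulary
  of the tree's ACC+ Thm. 6.1.1 (`C = Γ_{F(ζ_p)} = absGaloisGroupAdjoinRootsOfUnity F p`),
  `exists_finset_forall_splitPrimes_range_comp_absGaloisRestrict_eq` —
  `(τ ∘ res)(Γ_E) = τ(Γ_F)` and `(τ ∘ res)(Γ_{E(ζ_p)}) = τ(Γ_{F(ζ_p)})` — and
  `exists_finset_forall_splitPrimes_residual_hypotheses_transfer` — the same plus the transfer of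
  hypothesis (4): every `σ ∈ Γ_F` has `σ' ∈ Γ_E` with `τ(res σ') = τ σ` and
  `σ' ∈ Γ_{E(ζ_p)} ↔ σ ∈ Γ_{F(ζ_p)}`.

These serve the named fact
`Literature.NumberTheory.Automorphic.ACCGHLNSTT2023.automorphyLifting_crystalline_weightZero`
(`Automorphic/ACCAutomorphyLiftingCrystalline.lean`), whose hypotheses hand over exactly a
residual representation `τ` of `ρ` (open kernel: `FramedGaloisRep.isOpen_ker_of_isResidualRepOf`,
`ResidualGaloisRepOpenKernel.lean`) and the subgroup `absGaloisGroupAdjoinRootsOfUnity F p`.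

## References

* [ACCGHLNSTT2023] P. B. Allen et al., *Potential automorphy over CM fields*, Ann. of Math. (2)
  197 (2023), 897–1113, §6.5.12 (proof of Thm. 6.1.1), choice of `V₀, V₁`
  (arXiv:1812.09999, p. 88).
* [NeukirchANT1999] J. Neukirch, *Algebraic Number Theory* (1999), Ch. I §8 (towers), Ch. IV §1
  Thm. (1.2) (Krull's Galois correspondence), Ch. VII (13.4) (Bauer).
* [Marcus2018] D. A. Marcus, *Number Fields*, 2nd ed. (2018), Ch. 4, Thm. 29 and Exercise 10
  (complete splitting in subfields and composita).
* [CHT2008] L. Clozel, M. Harris, R. Taylor, *Automorphy for some `l`-adic lifts of automorphic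
  mod `l` Galois representations*, Publ. Math. IHÉS 108 (2008), §4.2 (the same device).
-/

noncomputable section

open NumberField IsDedekindDomain Field

open scoped Classical

namespace Literature.NumberTheory.NumberFields

open Literature.NumberTheory.GaloisRepresentations

/-! ### §1. Completely split primes along towers, isomorphisms and composita -/

section Tower

variable {M N N' : Type*} [Field M] [NumberField M] [Field N] [NumberField N] [Field N']
  [NumberField N'] [Algebra M N] [Algebra M N']

/-- **Complete splitting descends along a tower** `M ⊆ N ⊆ N'`: a prime of `M` that splits
completely in `N'` splits completely in `N` (unramifiedness descends, Mathlib
`Algebra.IsUnramifiedAt.of_liesOver`; residue degrees are multiplicative, Mathlib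
`Ideal.inertiaDeg_tower`). [folklore] -/
theorem splitPrimes_subset_of_isScalarTower [Algebra N N'] [IsScalarTower M N N'] :
    splitPrimes M N' ⊆ splitPrimes M N := by
  intro q hq
  obtain ⟨hunr, hf⟩ := (mem_splitPrimes_iff.mp hq)
  -- every prime `Q` of `𝓞 N` above `q` lies below a prime `Q'` of `𝓞 N'`, itself above `q`
  have key : ∀ Q : Ideal (𝓞 N), Q.IsPrime → Q.LiesOver q.asIdeal →
      ∃ Q' : Ideal (𝓞 N'), Q'.IsPrime ∧ Q'.LiesOver Q ∧ Q'.LiesOver q.asIdeal := by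
    intro Q hQ hQq
    haveI := hQ
    haveI := hQq
    have hQne : Q ≠ ⊥ := Ideal.ne_bot_of_liesOver_of_ne_bot q.ne_bot Q
    haveI : Q.IsMaximal := hQ.isMaximal hQne
    obtain ⟨Q', hQ'max, hQ'over⟩ :=
      Ideal.exists_maximal_ideal_liesOver_of_isIntegral (S := 𝓞 N') Q
    haveI := hQ'over
    exact ⟨Q', hQ'max.isPrime, hQ'over, Ideal.LiesOver.trans Q' Q q.asIdeal⟩
  refine mem_splitPrimes_iff.mpr ⟨fun Q hQ hQq => ?_, fun Q hQ => ?_⟩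
  · obtain ⟨Q', hQ', hQ'Q, hQ'q⟩ := key Q hQ hQq
    haveI := hQ
    haveI := hQ'
    haveI := hQ'Q
    haveI : Algebra.IsUnramifiedAt (𝓞 M) Q' := hunr Q' hQ' hQ'q
    exact Algebra.IsUnramifiedAt.of_liesOver (𝓞 M) Q Q'
  · obtain ⟨Q', hQ', hQ'Q, hQ'q⟩ := key Q hQ.1 hQ.2
    haveI := hQ.1
    haveI := hQ'
    haveI := hQ'Q
    have h1 : Q'.inertiaDeg (𝓞 M) = 1 := hf Q' ⟨hQ', hQ'q⟩
    rw [Ideal.inertiaDeg_tower Q Q'] at h1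
    exact Nat.eq_one_of_mul_eq_one_right h1

/-- **Complete splitting is invariant under `M`-isomorphisms** `N ≃ₐ[M] N'`. [folklore] -/
theorem splitPrimes_congr (e : N ≃ₐ[M] N') : splitPrimes M N = splitPrimes M N' := by
  refine le_antisymm ?_ ?_
  · letI : Algebra N' N := (e.symm : N' →ₐ[M] N).toRingHom.toAlgebra
    haveI : IsScalarTower M N' N := IsScalarTower.of_algebraMap_eq fun x =>
      ((e.symm : N' →ₐ[M] N).commutes x).symm
    exact splitPrimes_subset_of_isScalarTower
  · letI : Algebra N N' := (e : N →ₐ[M] N').toRingHom.toAlgebra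
    haveI : IsScalarTower M N N' := IsScalarTower.of_algebraMap_eq fun x =>
      ((e : N →ₐ[M] N').commutes x).symm
    exact splitPrimes_subset_of_isScalarTower

end Tower

section Subfields

variable {M Ω : Type*} [Field M] [NumberField M] [Field Ω] [Algebra M Ω]

omit [NumberField M] in
/-- A subfield of a finite extension of `M` (inside any `Ω ⊇ M`) is finite over `M`. [folklore] -/
theorem finiteDimensional_of_le {E E' : IntermediateField M Ω} [FiniteDimensional M E]
    (h : E' ≤ E) : FiniteDimensional M E' :=
  FiniteDimensional.of_injective (IntermediateField.inclusion h).toLinearMap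
    (IntermediateField.inclusion_injective h)

/-- A subfield of a finite extension of a number field `M` (inside any `Ω ⊇ M`) is a number
field. [folklore] -/
theorem numberField_of_le {E E' : IntermediateField M Ω} [FiniteDimensional M E]
    (h : E' ≤ E) : NumberField E' :=
  haveI := finiteDimensional_of_le h
  NumberField.of_module_finite M E'

/-- **Complete splitting descends to subfields** of a finite extension inside any ambient field
`Ω ⊇ M` (e.g. `Ω = M̄`): `E' ≤ E`, `q` splits completely in `E` ⟹ in `E'`. [folklore] -/
theorem splitPrimes_subset_of_le {E E' : IntermediateField M Ω} [FiniteDimensional M E]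
    (h : E' ≤ E) : splitPrimes M E ⊆ splitPrimes M E' := by
  haveI : FiniteDimensional M E' := finiteDimensional_of_le h
  haveI : NumberField E := NumberField.of_module_finite M E
  haveI : NumberField E' := NumberField.of_module_finite M E'
  letI : Algebra E' E := (IntermediateField.inclusion h).toRingHom.toAlgebra
  haveI : IsScalarTower M E' E := IsScalarTower.of_algebraMap_eq fun x =>
    ((IntermediateField.inclusion h).commutes x).symm
  exact splitPrimes_subset_of_isScalarTower

end Subfields

section Compositum

variable {F : Type} [Field F] [NumberField F]

/-- **Complete splitting ascends to composita of finite Galois subfields of `F̄`**: if `q` splits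
completely in `E₁` and in `E₂` (finite Galois over `F`, inside `F̄`) then it splits completely in
`E₁ E₂` (Marcus, *Number Fields*, Ch. 4, Exercise 10 (c)).  Reduced to the tree's finite-level
`mem_splitPrimes_sup` inside `L = E₁ E₂`, where `q` is unramified (`isUnramifiedIn_sup`).
[cite: Marcus2018, Ch. 4, Exercise 10] -/
theorem mem_splitPrimes_sup_of_isGalois {E₁ E₂ : IntermediateField F (AlgebraicClosure F)}
    [FiniteDimensional F E₁] [IsGalois F E₁] [FiniteDimensional F E₂] [IsGalois F E₂]
    {q : HeightOneSpectrum (𝓞 F)} (h₁ : q ∈ splitPrimes F E₁) (h₂ : q ∈ splitPrimes F E₂) :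
    q ∈ splitPrimes F (E₁ ⊔ E₂ : IntermediateField F (AlgebraicClosure F)) := by
  set L : IntermediateField F (AlgebraicClosure F) := E₁ ⊔ E₂ with hL
  haveI : IsGalois F L := isGalois_iff.mpr ⟨inferInstance, inferInstance⟩
  haveI : NumberField L := NumberField.of_module_finite F L
  haveI : NumberField E₁ := NumberField.of_module_finite F E₁
  haveI : NumberField E₂ := NumberField.of_module_finite F E₂
  -- `q` is unramified in `L = E₁ E₂`
  have hunr : Algebra.IsUnramifiedIn (𝓞 L) q.asIdeal :=
    isUnramifiedIn_sup (mem_splitPrimes_iff.mp h₁).1 (mem_splitPrimes_iff.mp h₂).1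
  -- view `E₁, E₂` as intermediate fields of `L / F`
  have hle₁ : E₁ ≤ L := le_sup_left
  have hle₂ : E₂ ≤ L := le_sup_right
  have h₁' : q ∈ splitPrimes F (IntermediateField.restrict hle₁) := by
    rwa [← splitPrimes_congr (IntermediateField.restrict_algEquiv hle₁)]
  have h₂' : q ∈ splitPrimes F (IntermediateField.restrict hle₂) := by
    rwa [← splitPrimes_congr (IntermediateField.restrict_algEquiv hle₂)]
  have hsup := mem_splitPrimes_sup hunr h₁' h₂'
  have htop : IntermediateField.restrict hle₁ ⊔ IntermediateField.restrict hle₂ =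
      (⊤ : IntermediateField F L) := by
    apply IntermediateField.lift_injective L
    rw [IntermediateField.lift_sup, IntermediateField.lift_restrict,
      IntermediateField.lift_restrict, IntermediateField.lift_top]
  rw [htop, splitPrimes_congr (IntermediateField.topEquiv (F := F) (E := L))] at hsup
  exact hsup

end Compositum

/-! ### §2. Images of `Γ_F` under `τ`: the Galois correspondence for open subgroups -/

section Images

variable {F : Type} [Field F] [NumberField F]

/-- **`E ∩ F̄^{ker τ} = F ⟹ τ(Γ_E) = τ(Γ_F)`** for a finite subextension `E ⊆ F̄` and any
homomorphism `τ` on `Γ_F` (Krull's Galois correspondence: `Γ_E · ker τ` is an open, hence closed,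
subgroup whose fixed field lies in `E` and in `F̄^{ker τ}`, hence is `F`, so `Γ_E · ker τ = Γ_F`).
This is "`ρ̄(G_E) = ρ̄(G_F)`" of ACC+ (proof of Thm. 6.1.1, §6.5.12) for `τ = ρ̄`.
[cite: ACCGHLNSTT2023, §6.5.12] [cite: NeukirchANT1999, Ch. IV §1 Thm. (1.2)] -/
theorem map_fixingSubgroup_eq_range_of_inf_fixedField_ker_eq_bot {H : Type*} [Group H]
    (τ : absoluteGaloisGroup F →* H) (E : IntermediateField F (AlgebraicClosure F))
    [FiniteDimensional F E]
    (h : E ⊓ IntermediateField.fixedField τ.ker = ⊥) :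
    (E.fixingSubgroup : Subgroup (absoluteGaloisGroup F)).map τ = τ.range := by
  -- work with `Γ_E` as a subgroup `ΓE` of `Γ_F` (`Field.absoluteGaloisGroup F` is a type synonym)
  suffices key : ∀ ΓE : Subgroup (absoluteGaloisGroup F),
      IsOpen (ΓE : Set (absoluteGaloisGroup F)) →
      (IntermediateField.fixedField ΓE : IntermediateField F (AlgebraicClosure F)) = E →
      ΓE.map τ = τ.range from
    key _ (IntermediateField.fixingSubgroup_isOpen E) (InfiniteGalois.fixedField_fixingSubgroup E)
  intro ΓE hEopen hEfix
  -- the open subgroup `Γ_E · ker τ`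
  set H' : Subgroup (absoluteGaloisGroup F) := ΓE ⊔ τ.ker with hH'
  have hH'open : IsOpen (H' : Set (absoluteGaloisGroup F)) :=
    Subgroup.isOpen_mono le_sup_left hEopen
  -- its fixed field lies in `E` and in `F̄^{ker τ}`, hence is `F`
  have hfix : (IntermediateField.fixedField H' : IntermediateField F (AlgebraicClosure F)) = ⊥ := by
    refine le_bot_iff.mp (h ▸ le_inf ?_ ?_)
    · calc IntermediateField.fixedField H' ≤ IntermediateField.fixedField ΓE :=
            IntermediateField.fixedField_le le_sup_left
        _ = E := hEfix
    · exact IntermediateField.fixedField_le le_sup_right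
  -- hence `Γ_E · ker τ = Γ_F` (Galois correspondence for the open subgroup `H'`)
  have htop : H' = ⊤ := by
    rw [← fixingSubgroup_fixedField_of_isOpen H' hH'open, hfix]
    exact IntermediateField.fixingSubgroup_bot
  -- images
  refine le_antisymm (Subgroup.map_le_range τ _) fun x hx => ?_
  obtain ⟨γ, rfl⟩ := MonoidHom.mem_range.mp hx
  have hγ : γ ∈ ((ΓE ⊔ τ.ker : Subgroup (absoluteGaloisGroup F)) : Set (absoluteGaloisGroup F)) := by
    rw [← hH', htop]
    exact Subgroup.mem_top γ
  rw [Subgroup.mul_normal] at hγ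
  obtain ⟨e, he, k, hk, rfl⟩ := Set.mem_mul.mp hγ
  refine Subgroup.mem_map.mpr ⟨e, he, ?_⟩
  rw [map_mul, (MonoidHom.mem_ker).mp hk, mul_one]

/-- **`E F₁ ∩ F̄^{ker τ ∩ C} = F₁ ⟹ τ(Γ_E ∩ C) = τ(C)`** for an open normal subgroup `C ≤ Γ_F`
with fixed field `F₁ = F̄^C` and a finite subextension `E ⊆ F̄` (the same Galois-correspondence
argument with the open subgroup `Γ_{E F₁} · (ker τ ∩ C) = C`).  This is
"`ρ̄(G_{E(ζ_p)}) = ρ̄(G_{F(ζ_p)})`" of ACC+ (loc. cit.) for `C = Γ_{F(ζ_p)}`.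
[cite: ACCGHLNSTT2023, §6.5.12] [cite: NeukirchANT1999, Ch. IV §1 Thm. (1.2)] -/
theorem map_fixingSubgroup_inf_eq_of_sup_inf_fixedField_eq {H : Type*} [Group H]
    (τ : absoluteGaloisGroup F →* H) (C : Subgroup (absoluteGaloisGroup F)) [C.Normal]
    (hC : IsOpen (C : Set (absoluteGaloisGroup F)))
    (E : IntermediateField F (AlgebraicClosure F)) [FiniteDimensional F E]
    (h : (E ⊔ IntermediateField.fixedField C) ⊓ IntermediateField.fixedField (τ.ker ⊓ C) =
      IntermediateField.fixedField C) :
    ((E.fixingSubgroup : Subgroup (absoluteGaloisGroup F)) ⊓ C).map τ = C.map τ := by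
  set F₁ : IntermediateField F (AlgebraicClosure F) := IntermediateField.fixedField C with hF₁
  have hF₁C : (F₁.fixingSubgroup : Subgroup (absoluteGaloisGroup F)) = C :=
    fixingSubgroup_fixedField_of_isOpen C hC
  haveI : FiniteDimensional F F₁ := finiteDimensional_fixedField_of_isOpen C hC
  -- `Γ_{E F₁} = Γ_E ∩ C`
  have hEF : ((E ⊔ F₁ : IntermediateField F (AlgebraicClosure F)).fixingSubgroup :
      Subgroup (absoluteGaloisGroup F)) =
      (E.fixingSubgroup : Subgroup (absoluteGaloisGroup F)) ⊓ C := by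
    rw [IntermediateField.fixingSubgroup_sup, ← hF₁C]
  -- work with `Γ_{E F₁}` as a subgroup `ΓEF` of `Γ_F`
  suffices key : ∀ ΓEF : Subgroup (absoluteGaloisGroup F),
      ΓEF = (E.fixingSubgroup : Subgroup (absoluteGaloisGroup F)) ⊓ C →
      IsOpen (ΓEF : Set (absoluteGaloisGroup F)) →
      (IntermediateField.fixedField ΓEF : IntermediateField F (AlgebraicClosure F)) = E ⊔ F₁ →
      ((E.fixingSubgroup : Subgroup (absoluteGaloisGroup F)) ⊓ C).map τ = C.map τ from
    key _ hEF (IntermediateField.fixingSubgroup_isOpen (E ⊔ F₁ : IntermediateField F _))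
      (InfiniteGalois.fixedField_fixingSubgroup (E ⊔ F₁ : IntermediateField F _))
  intro ΓEF hΓEF hopen hfixEF
  rw [← hΓEF]
  set N : Subgroup (absoluteGaloisGroup F) := τ.ker ⊓ C with hN
  haveI : N.Normal := by rw [hN]; infer_instance
  -- the open subgroup `Γ_{E F₁} · N ≤ C`
  set H' : Subgroup (absoluteGaloisGroup F) := ΓEF ⊔ N with hH'
  have hle : H' ≤ C := sup_le (hΓEF ▸ inf_le_right) inf_le_right
  have hH'open : IsOpen (H' : Set (absoluteGaloisGroup F)) :=
    Subgroup.isOpen_mono le_sup_left hopen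
  -- its fixed field lies in `E F₁` and in `F̄^N`, hence in `F₁`
  have hfix : (IntermediateField.fixedField H' : IntermediateField F (AlgebraicClosure F)) ≤ F₁ := by
    refine h ▸ le_inf ?_ ?_
    · calc IntermediateField.fixedField H' ≤ IntermediateField.fixedField ΓEF :=
            IntermediateField.fixedField_le le_sup_left
        _ = E ⊔ F₁ := hfixEF
    · exact IntermediateField.fixedField_le le_sup_right
  -- hence `C = Γ_{F₁} ≤ H'`, so `H' = C`
  have hge : C ≤ H' := by
    have h1 : (F₁.fixingSubgroup : Subgroup (absoluteGaloisGroup F)) ≤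
        ((IntermediateField.fixedField H' : IntermediateField F (AlgebraicClosure F)).fixingSubgroup :
          Subgroup (absoluteGaloisGroup F)) :=
      IntermediateField.fixingSubgroup_le hfix
    rwa [fixingSubgroup_fixedField_of_isOpen H' hH'open, hF₁C] at h1
  have hH'C : H' = C := le_antisymm hle hge
  -- images
  refine le_antisymm (Subgroup.map_mono (hΓEF ▸ inf_le_right)) fun x hx => ?_
  obtain ⟨c, hc, rfl⟩ := Subgroup.mem_map.mp hx
  have hc' : c ∈ ((ΓEF ⊔ N : Subgroup (absoluteGaloisGroup F)) : Set (absoluteGaloisGroup F)) := by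
    rw [← hH', hH'C]
    exact hc
  rw [Subgroup.mul_normal] at hc'
  obtain ⟨e, he, k, hk, rfl⟩ := Set.mem_mul.mp hc'
  refine Subgroup.mem_map.mpr ⟨e, he, ?_⟩
  rw [map_mul, (MonoidHom.mem_ker).mp hk.1, mul_one]

/-- **`E ∩ F̄^N = F ⟹ Γ_E · N = Γ_F`** for a finite subextension `E ⊆ F̄` and ANY subgroup
`N ≤ Γ_F` (Krull's Galois correspondence: `Γ_E · N ⊇ Γ_E` is open, hence closed, and its fixed
field lies in `E` and in `F̄^N`, hence is `F`).  With `N = ker ρ̄ ∩ Γ_{F(ζ_p)}` — so that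
`F̄^N = K` is "the extension of `F(ζ_p)` cut out by `ρ̄|_{G_{F(ζ_p)}}`" of ACC+ §6.5.12 — this is
the group-theoretic content of "`E ∩ K = F` … In particular `ρ̄(G_E) = ρ̄(G_F)` and
`ρ̄(G_{E(ζ_p)}) = ρ̄(G_{F(ζ_p)})`", and it moreover transfers hypothesis (4) of Thm. 6.1.1 (a
scalar `ρ̄(σ)`, `σ ∉ G_{F(ζ_p)}`) from `F` to `E`. [cite: ACCGHLNSTT2023, §6.5.12]
[cite: NeukirchANT1999, Ch. IV §1 Thm. (1.2)] -/
theorem fixingSubgroup_sup_eq_top_of_inf_fixedField_eq_bot (N : Subgroup (absoluteGaloisGroup F))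
    (E : IntermediateField F (AlgebraicClosure F)) [FiniteDimensional F E]
    (h : E ⊓ IntermediateField.fixedField N = ⊥) :
    (E.fixingSubgroup : Subgroup (absoluteGaloisGroup F)) ⊔ N = ⊤ := by
  -- work with `Γ_E` as a subgroup `ΓE` of `Γ_F`
  suffices key : ∀ ΓE : Subgroup (absoluteGaloisGroup F),
      IsOpen (ΓE : Set (absoluteGaloisGroup F)) →
      (IntermediateField.fixedField ΓE : IntermediateField F (AlgebraicClosure F)) = E →
      ΓE ⊔ N = ⊤ from
    key _ (IntermediateField.fixingSubgroup_isOpen E) (InfiniteGalois.fixedField_fixingSubgroup E)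
  intro ΓE hEopen hEfix
  set H' : Subgroup (absoluteGaloisGroup F) := ΓE ⊔ N with hH'
  have hH'open : IsOpen (H' : Set (absoluteGaloisGroup F)) :=
    Subgroup.isOpen_mono le_sup_left hEopen
  have hfix : (IntermediateField.fixedField H' : IntermediateField F (AlgebraicClosure F)) = ⊥ := by
    refine le_bot_iff.mp (h ▸ le_inf ?_ ?_)
    · calc IntermediateField.fixedField H' ≤ IntermediateField.fixedField ΓE :=
            IntermediateField.fixedField_le le_sup_left
        _ = E := hEfix
    · exact IntermediateField.fixedField_le le_sup_right
  rw [← fixingSubgroup_fixedField_of_isOpen H' hH'open, hfix]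
  exact IntermediateField.fixingSubgroup_bot

/-- **Unpacking `Γ_E · N = Γ_F`**: if `Γ' ⊔ N = ⊤` with `N` normal, every `σ ∈ Γ_F` is `σ = e k`
with `e ∈ Γ'`, `k ∈ N`. [folklore] -/
theorem exists_mul_eq_of_sup_eq_top {G : Type*} [Group G] {Γ' N : Subgroup G} [N.Normal]
    (h : Γ' ⊔ N = ⊤) (σ : G) : ∃ e ∈ Γ', ∃ k ∈ N, e * k = σ := by
  have hσ : σ ∈ ((Γ' ⊔ N : Subgroup G) : Set G) := by
    rw [h]
    exact Subgroup.mem_top σ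
  rw [Subgroup.mul_normal] at hσ
  obtain ⟨e, he, k, hk, rfl⟩ := Set.mem_mul.mp hσ
  exact ⟨e, he, k, hk, rfl⟩

/-- **Consequences of `Γ' · (ker τ ∩ C) = Γ_F`** for a subgroup `Γ' ≤ Γ_F` (e.g. `Γ' = Γ_E`):
every `σ` has a representative `e ∈ Γ'` with `τ e = τ σ` and `e ∈ C ↔ σ ∈ C`; in particular
`τ(Γ') = τ(Γ_F)` and `τ(Γ' ∩ C) = τ(C)`. [folklore] -/
theorem forall_exists_mem_of_sup_ker_inf_eq_top {G H : Type*} [Group G] [Group H] (τ : G →* H)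
    {Γ' C : Subgroup G} [C.Normal] (h : Γ' ⊔ (τ.ker ⊓ C) = ⊤) :
    (∀ σ : G, ∃ e ∈ Γ', τ e = τ σ ∧ (e ∈ C ↔ σ ∈ C)) ∧
      Γ'.map τ = τ.range ∧ (Γ' ⊓ C).map τ = C.map τ := by
  haveI : (τ.ker ⊓ C).Normal := inferInstance
  have key : ∀ σ : G, ∃ e ∈ Γ', τ e = τ σ ∧ (e ∈ C ↔ σ ∈ C) := by
    intro σ
    obtain ⟨e, he, k, hk, rfl⟩ := exists_mul_eq_of_sup_eq_top h σ
    refine ⟨e, he, ?_, ?_⟩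
    · rw [map_mul, (MonoidHom.mem_ker).mp hk.1, mul_one]
    · constructor
      · intro heC
        exact C.mul_mem heC hk.2
      · intro hσ
        have := C.mul_mem hσ (C.inv_mem hk.2)
        rwa [mul_inv_cancel_right] at this
  refine ⟨key, ?_, ?_⟩
  · refine le_antisymm (Subgroup.map_le_range τ _) fun x hx => ?_
    obtain ⟨σ, rfl⟩ := MonoidHom.mem_range.mp hx
    obtain ⟨e, he, heq, -⟩ := key σ
    exact Subgroup.mem_map.mpr ⟨e, he, heq⟩
  · refine le_antisymm (Subgroup.map_mono inf_le_right) fun x hx => ?_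
    obtain ⟨c, hc, rfl⟩ := Subgroup.mem_map.mp hx
    obtain ⟨e, he, heq, heC⟩ := key c
    exact Subgroup.mem_map.mpr ⟨e, ⟨he, heC.mpr hc⟩, heq⟩

end Images

/-! ### §3. The printed statement, absolute form -/

section Main

variable {F : Type} [Field F] [NumberField F]

/-- **`V`-split extensions do not change `τ(Γ_F)` nor `τ(C)`** (ACC+ Thm. 6.1.1, proof, §6.5.12,
absolute form).  Let `τ : Γ_F → H` be a homomorphism with open kernel (e.g. a residual Galois
representation `ρ̄`), `C ≤ Γ_F` an open normal subgroup (e.g. `Γ_{F(ζ_p)}`) and `S` a finite set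
of finite places of `F`.  There is a finite set `V` of finite places of `F`, disjoint from `S`,
of prime absolute norm (degree one), with `τ(I_𝔓) = 1` and `I_𝔓 ≤ C` for every prime `𝔓` of
`\bar ℤ_F` above `V` (i.e. unramified in `K = F̄^{ker τ ∩ C}`), such that for EVERY finite Galois
subextension `E ⊆ F̄` of `F` in which all places of `V` split completely:
`τ(Γ_E) = τ(Γ_F)` and `τ(Γ_E ∩ C) = τ(C)`.  Printed: "Let `K/F(ζ_p)` be the extension cut out
by `ρ̄|_{G_{F(ζ_p)}}`. Choose finite sets `V₀, V₁` … for each proper subfield `K/K'/F(ζ_p)`,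
there exists `v ∈ V₀` such that `v` splits in `F(ζ_p)` but does not split in `K'`. For each
proper subfield `K/K'/F`, there exists `v ∈ V₁` which does not split in `K'`. … Note that if
`E/F` is any finite Galois extension which is `V₀ ∪ V₁`-split, then `E ∩ K = F` … In particular,
`E` is linearly disjoint from `K`, and therefore `ρ̄(G_E) = ρ̄(G_F)` and
`ρ̄(G_{E(ζ_p)}) = ρ̄(G_{F(ζ_p)})`."  Proof: `V = V₁ ∪ V₀` of the tree's finite-level
`exists_finset_forall_not_mem_splitPrimes(_of_le)` inside `K`; a `V₁`-split `E` has `E ∩ K = F`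
and a `V₀`-split `E` has `E F₁ ∩ K = F₁` (`F₁ = F̄^C`; complete splitting descends to subfields
and ascends to the compositum `E F₁`), and §2 concludes.  Galoisness of `E` is used only for the
second equality. [cite: ACCGHLNSTT2023, §6.5.12 (choice of `V₀`, `V₁`)] -/
theorem exists_finset_forall_splitPrimes_map_fixingSubgroup_eq {H : Type*} [Group H]
    (τ : absoluteGaloisGroup F →* H) (hτ : IsOpen (τ.ker : Set (absoluteGaloisGroup F)))
    (C : Subgroup (absoluteGaloisGroup F)) [C.Normal] (hC : IsOpen (C : Set (absoluteGaloisGroup F)))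
    (S : Set (HeightOneSpectrum (𝓞 F))) (hS : S.Finite) :
    ∃ V : Finset (HeightOneSpectrum (𝓞 F)),
      (∀ q ∈ V, q ∉ S ∧ (Ideal.absNorm q.asIdeal).Prime ∧
        ∀ 𝔓 ∈ q.primesAbove, ∀ γ ∈ 𝔓.inertia (absoluteGaloisGroup F), τ γ = 1 ∧ γ ∈ C) ∧
      ∀ E : IntermediateField F (AlgebraicClosure F), FiniteDimensional F E → IsGalois F E →
        (∀ q ∈ V, q ∈ splitPrimes F E) →
        (E.fixingSubgroup : Subgroup (absoluteGaloisGroup F)).map τ = τ.range ∧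
        ((E.fixingSubgroup : Subgroup (absoluteGaloisGroup F)) ⊓ C).map τ = C.map τ := by
  -- the finite Galois extensions `K = F̄^{ker τ ∩ C} ⊇ F₁ = F̄^C` of `F`
  set N : Subgroup (absoluteGaloisGroup F) := τ.ker ⊓ C with hN
  haveI : N.Normal := by rw [hN]; infer_instance
  have hNopen : IsOpen (N : Set (absoluteGaloisGroup F)) := hτ.inter hC
  set K : IntermediateField F (AlgebraicClosure F) := IntermediateField.fixedField N with hK
  set F₁ : IntermediateField F (AlgebraicClosure F) := IntermediateField.fixedField C with hF₁
  have hKN : (K.fixingSubgroup : Subgroup (absoluteGaloisGroup F)) = N :=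
    fixingSubgroup_fixedField_of_isOpen N hNopen
  have hF₁C : (F₁.fixingSubgroup : Subgroup (absoluteGaloisGroup F)) = C :=
    fixingSubgroup_fixedField_of_isOpen C hC
  haveI : FiniteDimensional F K := finiteDimensional_fixedField_of_isOpen N hNopen
  haveI : FiniteDimensional F F₁ := finiteDimensional_fixedField_of_isOpen C hC
  haveI : IsGalois F K := by
    rw [← InfiniteGalois.normal_iff_isGalois, hKN]
    exact ‹N.Normal›
  haveI : IsGalois F F₁ := by
    rw [← InfiniteGalois.normal_iff_isGalois, hF₁C]
    exact ‹C.Normal›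
  haveI : NumberField K := NumberField.of_module_finite F K
  haveI : NumberField F₁ := NumberField.of_module_finite F F₁
  have h₁ : F₁ ≤ K := IntermediateField.fixedField_le inf_le_right
  -- `F₁` as an intermediate field of `K / F`
  set F₁' : IntermediateField F K := IntermediateField.restrict h₁ with hF₁'
  haveI : IsGalois F F₁' := IsGalois.of_algEquiv (IntermediateField.restrict_algEquiv h₁)
  -- the detecting sets `V₁` (subfields of `K`) and `V₀` (subfields of `K` over `F₁`)
  obtain ⟨V₁, hV₁, hV₁'⟩ := exists_finset_forall_not_mem_splitPrimes (M := F) (L := K) S hS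
  obtain ⟨V₀, hV₀, hV₀'⟩ :=
    exists_finset_forall_not_mem_splitPrimes_of_le (M := F) (L := K) F₁' S hS
  refine ⟨V₁ ∪ V₀, fun q hq => ?_, fun E hEfd hEgal hE => ?_⟩
  · -- side conditions: outside `S`, degree one, unramified in `K` (inertia inside `N`)
    have hq' : q ∉ S ∧ (Ideal.absNorm q.asIdeal).Prime ∧ Algebra.IsUnramifiedIn (𝓞 K) q.asIdeal := by
      rcases Finset.mem_union.mp hq with h | h
      · exact hV₁ q h
      · exact ⟨(hV₀ q h).1, (hV₀ q h).2.1, (hV₀ q h).2.2.1⟩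
    refine ⟨hq'.1, hq'.2.1, fun 𝔓 h𝔓 γ hγ => ?_⟩
    have h1 : absRestrictNormalHom K γ = 1 :=
      (isUnramifiedIn_iff_forall_inertia_absRestrictNormalHom_eq_one K q).mp hq'.2.2 𝔓 h𝔓 γ hγ
    have hγK : γ ∈ (K.fixingSubgroup : Subgroup (absoluteGaloisGroup F)) :=
      (mem_fixingSubgroup_iff_forall_smul K γ).mpr
        ((absRestrictNormalHom_eq_one_iff_forall_smul K γ).mp h1)
    have hγN : γ ∈ N := hKN ▸ hγK
    exact ⟨hγN.1, hγN.2⟩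
  · haveI := hEfd
    haveI := hEgal
    have hE₁ : ∀ q ∈ V₁, q ∈ splitPrimes F E := fun q hq => hE q (Finset.mem_union_left _ hq)
    have hE₀ : ∀ q ∈ V₀, q ∈ splitPrimes F E := fun q hq => hE q (Finset.mem_union_right _ hq)
    refine ⟨?_, ?_⟩
    · -- `E ∩ K = F`
      have hEK : E ⊓ K = ⊥ := by
        by_contra hne
        haveI : NumberField (E ⊓ K : IntermediateField F (AlgebraicClosure F)) :=
          numberField_of_le (M := F) inf_le_left
        set K' : IntermediateField F K := IntermediateField.restrict (inf_le_right : E ⊓ K ≤ K)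
          with hK'
        have hK'ne : K' ≠ ⊥ := by
          intro hbot
          apply hne
          have h2 := congrArg IntermediateField.lift hbot
          rwa [hK', IntermediateField.lift_restrict, IntermediateField.lift_bot] at h2
        obtain ⟨q, hqV, hq⟩ := hV₁' K' hK'ne
        apply hq
        rw [hK', ← splitPrimes_congr (IntermediateField.restrict_algEquiv
          (inf_le_right : E ⊓ K ≤ K))]
        exact splitPrimes_subset_of_le inf_le_left (hE₁ q hqV)
      refine map_fixingSubgroup_eq_range_of_inf_fixedField_ker_eq_bot τ E ?_
      -- `F̄^{ker τ} ≤ K`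
      exact le_bot_iff.mp (hEK ▸ inf_le_inf_left E (IntermediateField.fixedField_le inf_le_left))
    · -- `E F₁ ∩ K = F₁`
      have hEK : (E ⊔ F₁) ⊓ K = F₁ := by
        by_contra hne
        haveI : NumberField ((E ⊔ F₁) ⊓ K : IntermediateField F (AlgebraicClosure F)) :=
          numberField_of_le (M := F) inf_le_right
        have hle₁ : F₁ ≤ (E ⊔ F₁) ⊓ K := le_inf le_sup_right h₁
        have hle₂ : (E ⊔ F₁) ⊓ K ≤ K := inf_le_right
        set K' : IntermediateField F K := IntermediateField.restrict hle₂ with hK'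
        have hF₁K' : F₁' ≤ K' := by
          intro x hx
          rw [hK', IntermediateField.mem_restrict]
          rw [hF₁', IntermediateField.mem_restrict] at hx
          exact hle₁ hx
        have hK'ne : K' ≠ F₁' := by
          intro heq
          apply hne
          have h2 := congrArg IntermediateField.lift heq
          rwa [hK', hF₁', IntermediateField.lift_restrict, IntermediateField.lift_restrict] at h2
        obtain ⟨q, hqV, hq⟩ := hV₀' K' hF₁K' hK'ne
        have hqF₁ : q ∈ splitPrimes F F₁' := (hV₀ q hqV).2.2.2
        apply hq
        rw [hK', ← splitPrimes_congr (IntermediateField.restrict_algEquiv hle₂)]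
        refine splitPrimes_subset_of_le inf_le_left ?_
        -- `q` splits completely in `E` and in `F₁`, hence in `E F₁`
        have hqF₁' : q ∈ splitPrimes F F₁ := by
          rwa [hF₁', ← splitPrimes_congr (IntermediateField.restrict_algEquiv h₁)] at hqF₁
        exact mem_splitPrimes_sup_of_isGalois (hE₀ q hqV) hqF₁'
      exact map_fixingSubgroup_inf_eq_of_sup_inf_fixedField_eq τ C hC E hEK

/-- **`V`-split extensions satisfy `Γ_E · (ker τ ∩ C) = Γ_F`** — the master form of the
avoidance step (ACC+ Thm. 6.1.1, proof, §6.5.12: "For each proper subfield `K/K'/F`, there exists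
`v ∈ V₁` which does not split in `K'` … if `E/F` is … `V₁`-split, then `E ∩ K = F`", with
`K = F̄^{ker τ ∩ C}` "the extension of `F(ζ_p)` cut out by `ρ̄|_{G_{F(ζ_p)}}`").  For `τ` with
open kernel, `C` open normal and `S` finite there is a finite set `V` of places of `F` outside
`S`, of prime absolute norm, with `τ(I_𝔓) = 1`, `I_𝔓 ≤ C` above `V`, such that EVERY finite
subextension `E ⊆ F̄` (Galois or not) in which all places of `V` split completely satisfies
`Γ_E ⊔ (ker τ ⊓ C) = ⊤`; whence (`forall_exists_mem_of_sup_ker_inf_eq_top`) `τ(Γ_E) = τ(Γ_F)`,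
`τ(Γ_E ∩ C) = τ(C)`, and every `σ ∈ Γ_F` has a representative `e ∈ Γ_E` with `τ e = τ σ`,
`e ∈ C ↔ σ ∈ C`. [cite: ACCGHLNSTT2023, §6.5.12 (choice of `V₁`)] -/
theorem exists_finset_forall_splitPrimes_fixingSubgroup_sup_eq_top {H : Type*} [Group H]
    (τ : absoluteGaloisGroup F →* H) (hτ : IsOpen (τ.ker : Set (absoluteGaloisGroup F)))
    (C : Subgroup (absoluteGaloisGroup F)) [C.Normal] (hC : IsOpen (C : Set (absoluteGaloisGroup F)))
    (S : Set (HeightOneSpectrum (𝓞 F))) (hS : S.Finite) :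
    ∃ V : Finset (HeightOneSpectrum (𝓞 F)),
      (∀ q ∈ V, q ∉ S ∧ (Ideal.absNorm q.asIdeal).Prime ∧
        ∀ 𝔓 ∈ q.primesAbove, ∀ γ ∈ 𝔓.inertia (absoluteGaloisGroup F), τ γ = 1 ∧ γ ∈ C) ∧
      ∀ E : IntermediateField F (AlgebraicClosure F), FiniteDimensional F E →
        (∀ q ∈ V, q ∈ splitPrimes F E) →
        (E.fixingSubgroup : Subgroup (absoluteGaloisGroup F)) ⊔ (τ.ker ⊓ C) = ⊤ := by
  -- the finite Galois extension `K = F̄^{ker τ ∩ C}` of `F`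
  set N : Subgroup (absoluteGaloisGroup F) := τ.ker ⊓ C with hN
  haveI : N.Normal := by rw [hN]; infer_instance
  have hNopen : IsOpen (N : Set (absoluteGaloisGroup F)) := hτ.inter hC
  set K : IntermediateField F (AlgebraicClosure F) := IntermediateField.fixedField N with hK
  have hKN : (K.fixingSubgroup : Subgroup (absoluteGaloisGroup F)) = N :=
    fixingSubgroup_fixedField_of_isOpen N hNopen
  haveI : FiniteDimensional F K := finiteDimensional_fixedField_of_isOpen N hNopen
  haveI : IsGalois F K := by
    rw [← InfiniteGalois.normal_iff_isGalois, hKN]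
    exact ‹N.Normal›
  haveI : NumberField K := NumberField.of_module_finite F K
  -- `V = V₁`, detecting the non-trivial subfields of `K`
  obtain ⟨V, hV, hV'⟩ := exists_finset_forall_not_mem_splitPrimes (M := F) (L := K) S hS
  refine ⟨V, fun q hq => ?_, fun E hEfd hE => ?_⟩
  · refine ⟨(hV q hq).1, (hV q hq).2.1, fun 𝔓 h𝔓 γ hγ => ?_⟩
    have h1 : absRestrictNormalHom K γ = 1 :=
      (isUnramifiedIn_iff_forall_inertia_absRestrictNormalHom_eq_one K q).mp (hV q hq).2.2 𝔓 h𝔓 γ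
        hγ
    have hγK : γ ∈ (K.fixingSubgroup : Subgroup (absoluteGaloisGroup F)) :=
      (mem_fixingSubgroup_iff_forall_smul K γ).mpr
        ((absRestrictNormalHom_eq_one_iff_forall_smul K γ).mp h1)
    have hγN : γ ∈ N := hKN ▸ hγK
    exact ⟨hγN.1, hγN.2⟩
  · haveI := hEfd
    -- `E ∩ K = F`
    have hEK : E ⊓ K = ⊥ := by
      by_contra hne
      haveI : NumberField (E ⊓ K : IntermediateField F (AlgebraicClosure F)) :=
        numberField_of_le (M := F) inf_le_left
      set K' : IntermediateField F K := IntermediateField.restrict (inf_le_right : E ⊓ K ≤ K)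
        with hK'
      have hK'ne : K' ≠ ⊥ := by
        intro hbot
        apply hne
        have h2 := congrArg IntermediateField.lift hbot
        rwa [hK', IntermediateField.lift_restrict, IntermediateField.lift_bot] at h2
      obtain ⟨q, hqV, hq⟩ := hV' K' hK'ne
      apply hq
      rw [hK', ← splitPrimes_congr (IntermediateField.restrict_algEquiv
        (inf_le_right : E ⊓ K ≤ K))]
      exact splitPrimes_subset_of_le inf_le_left (hE q hqV)
    exact fixingSubgroup_sup_eq_top_of_inf_fixedField_eq_bot N E hEK

end Main

/-! ### §4. Corollaries: `C = Γ_{F(ζ_p)}`; abstract Galois extensions `E/F` -/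

section Abstract

variable {F : Type} [Field F] [NumberField F]

/-- **Abstract form** of `exists_finset_forall_splitPrimes_map_fixingSubgroup_eq`: for a finite
Galois extension `E/F` given as an `F`-algebra (not as a subfield of `F̄`), with `Γ_E → Γ_F` the
tree's restriction map `absGaloisRestrict F E` (whose image is `Gal(F̄/E')` for a copy `E' ⊆ F̄`
of `E`, `exists_mem_range_absGaloisRestrict_iff`): if all places of `V` split completely in `E`
then `τ(res Γ_E) = τ(Γ_F)` and `τ(res Γ_E ∩ C) = τ(C)`. [cite: ACCGHLNSTT2023, §6.5.12] -/
theorem exists_finset_forall_splitPrimes_map_range_absGaloisRestrict_eq {H : Type*} [Group H]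
    (τ : absoluteGaloisGroup F →* H) (hτ : IsOpen (τ.ker : Set (absoluteGaloisGroup F)))
    (C : Subgroup (absoluteGaloisGroup F)) [C.Normal] (hC : IsOpen (C : Set (absoluteGaloisGroup F)))
    (S : Set (HeightOneSpectrum (𝓞 F))) (hS : S.Finite) :
    ∃ V : Finset (HeightOneSpectrum (𝓞 F)),
      (∀ q ∈ V, q ∉ S ∧ (Ideal.absNorm q.asIdeal).Prime ∧
        ∀ 𝔓 ∈ q.primesAbove, ∀ γ ∈ 𝔓.inertia (absoluteGaloisGroup F), τ γ = 1 ∧ γ ∈ C) ∧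
      ∀ (E : Type) [Field E] [NumberField E] [Algebra F E], IsGalois F E →
        (∀ q ∈ V, q ∈ splitPrimes F E) →
        ((absGaloisRestrict F E).range : Subgroup (absoluteGaloisGroup F)).map τ = τ.range ∧
        (((absGaloisRestrict F E).range : Subgroup (absoluteGaloisGroup F)) ⊓ C).map τ =
          C.map τ := by
  obtain ⟨V, hV, hV'⟩ := exists_finset_forall_splitPrimes_map_fixingSubgroup_eq τ hτ C hC S hS
  refine ⟨V, hV, fun E _ _ _ hEgal hE => ?_⟩
  -- `res(Γ_E) = Gal(F̄/E')` for the copy `E' = e(E) ⊆ F̄` of `E`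
  obtain ⟨e, he⟩ := exists_mem_range_absGaloisRestrict_iff F E
  set E' : IntermediateField F (AlgebraicClosure F) := e.fieldRange with hE'
  have eE : E ≃ₐ[F] E' := e.equivFieldRange
  have hrange : ((absGaloisRestrict F E).range : Subgroup (absoluteGaloisGroup F)) =
      (E'.fixingSubgroup : Subgroup (absoluteGaloisGroup F)) := by
    ext g
    refine (he g).trans (Iff.trans ?_ (mem_fixingSubgroup_iff_forall_smul E' g).symm)
    constructor
    · rintro h ⟨x, ⟨k, rfl⟩⟩
      exact h k
    · intro h k
      exact h ⟨e k, ⟨k, rfl⟩⟩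
  haveI : FiniteDimensional F E' := LinearEquiv.finiteDimensional eE.toLinearEquiv
  haveI : IsGalois F E' := IsGalois.of_algEquiv eE
  haveI : NumberField E' := NumberField.of_module_finite F E'
  have hE'split : ∀ q ∈ V, q ∈ splitPrimes F E' := fun q hq => by
    rw [← splitPrimes_congr eE]
    exact hE q hq
  obtain ⟨h1, h2⟩ := hV' E' inferInstance inferInstance hE'split
  rw [hrange]
  exact ⟨h1, h2⟩

/-- **ACC+ Thm. 6.1.1, proof, §6.5.12, in the vocabulary of the tree's statement of the theorem**
(`Automorphic/ACCAutomorphyLiftingCrystalline.lean`: `τ = ρ̄ : Γ_F → GL_n(k)` with open kernel —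
e.g. a residual representation of a continuous `p`-adic `ρ`, `ResidualGaloisRepOpenKernel.lean` —
and `Γ_{F(ζ_p)} = absGaloisGroupAdjoinRootsOfUnity F p`).  For every finite `S` there is a finite
set `V` of finite places of `F` outside `S`, of prime absolute norm, with `ρ̄(I_𝔓) = 1` and
`I_𝔓 ≤ Γ_{F(ζ_p)}` above `V`, such that for every finite Galois extension `E/F` in which all
places of `V` split completely, `ρ̄|_{Γ_E} = ρ̄ ∘ res` satisfies
**`ρ̄(Γ_E) = ρ̄(Γ_F)` and `ρ̄(Γ_{E(ζ_p)}) = ρ̄(Γ_{F(ζ_p)})`**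
(`Γ_{E(ζ_p)} = res⁻¹(Γ_{F(ζ_p)})`, `mem_absGaloisGroupAdjoinRootsOfUnity_iff_absGaloisRestrict`).
Printed: "if `E/F` is any finite Galois extension which is `V₀ ∪ V₁ ∪ V₂`-split, then … `E` is
linearly disjoint from `K`, and therefore `ρ̄(G_E) = ρ̄(G_F)` and
`ρ̄(G_{E(ζ_p)}) = ρ̄(G_{F(ζ_p)})`." [cite: ACCGHLNSTT2023, §6.5.12 (proof of Thm. 6.1.1, p. 88 of
arXiv:1812.09999)] -/
theorem exists_finset_forall_splitPrimes_range_comp_absGaloisRestrict_eq {H : Type*} [Group H]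
    (τ : absoluteGaloisGroup F →* H) (hτ : IsOpen (τ.ker : Set (absoluteGaloisGroup F)))
    (p : ℕ) [Fact p.Prime] (S : Set (HeightOneSpectrum (𝓞 F))) (hS : S.Finite) :
    ∃ V : Finset (HeightOneSpectrum (𝓞 F)),
      (∀ q ∈ V, q ∉ S ∧ (Ideal.absNorm q.asIdeal).Prime ∧
        ∀ 𝔓 ∈ q.primesAbove, ∀ γ ∈ 𝔓.inertia (absoluteGaloisGroup F),
          τ γ = 1 ∧ γ ∈ absGaloisGroupAdjoinRootsOfUnity F p) ∧
      ∀ (E : Type) [Field E] [NumberField E] [Algebra F E], IsGalois F E →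
        (∀ q ∈ V, q ∈ splitPrimes F E) →
        (τ.comp (absGaloisRestrict F E).toMonoidHom).range = τ.range ∧
        (absGaloisGroupAdjoinRootsOfUnity E p).map (τ.comp (absGaloisRestrict F E).toMonoidHom) =
          (absGaloisGroupAdjoinRootsOfUnity F p).map τ := by
  have hp : p.Prime := Fact.out
  haveI := normal_absGaloisGroupAdjoinRootsOfUnity F p
  obtain ⟨V, hV, hV'⟩ := exists_finset_forall_splitPrimes_map_range_absGaloisRestrict_eq τ hτ
    (absGaloisGroupAdjoinRootsOfUnity F p) (isOpen_absGaloisGroupAdjoinRootsOfUnity F p hp.pos) S hS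
  refine ⟨V, hV, fun E _ _ _ hEgal hE => ?_⟩
  obtain ⟨h1, h2⟩ := hV' E hEgal hE
  refine ⟨?_, ?_⟩
  · rw [MonoidHom.range_comp]
    exact h1
  · rw [← Subgroup.map_map, ← h2]
    congr 1
    -- `res(Γ_{E(ζ_p)}) = res(Γ_E) ∩ Γ_{F(ζ_p)}`
    ext g
    constructor
    · rintro ⟨σ, hσ, rfl⟩
      exact ⟨⟨σ, rfl⟩,
        (mem_absGaloisGroupAdjoinRootsOfUnity_iff_absGaloisRestrict F E p σ).mp hσ⟩
    · rintro ⟨⟨σ, rfl⟩, hg⟩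
      exact ⟨σ, (mem_absGaloisGroupAdjoinRootsOfUnity_iff_absGaloisRestrict F E p σ).mpr hg, rfl⟩

/-- **Abstract form of `exists_finset_forall_splitPrimes_fixingSubgroup_sup_eq_top`**: for a
finite extension `E/F` given as an `F`-algebra, `res(Γ_E) · (ker τ ∩ C) = Γ_F` whenever all
places of `V` split completely in `E` (`res = absGaloisRestrict F E`, whose image is `Gal(F̄/E')`
for a copy `E' ⊆ F̄` of `E`). [cite: ACCGHLNSTT2023, §6.5.12] -/
theorem exists_finset_forall_splitPrimes_range_absGaloisRestrict_sup_eq_top {H : Type*} [Group H]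
    (τ : absoluteGaloisGroup F →* H) (hτ : IsOpen (τ.ker : Set (absoluteGaloisGroup F)))
    (C : Subgroup (absoluteGaloisGroup F)) [C.Normal] (hC : IsOpen (C : Set (absoluteGaloisGroup F)))
    (S : Set (HeightOneSpectrum (𝓞 F))) (hS : S.Finite) :
    ∃ V : Finset (HeightOneSpectrum (𝓞 F)),
      (∀ q ∈ V, q ∉ S ∧ (Ideal.absNorm q.asIdeal).Prime ∧
        ∀ 𝔓 ∈ q.primesAbove, ∀ γ ∈ 𝔓.inertia (absoluteGaloisGroup F), τ γ = 1 ∧ γ ∈ C) ∧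
      ∀ (E : Type) [Field E] [NumberField E] [Algebra F E],
        (∀ q ∈ V, q ∈ splitPrimes F E) →
        ((absGaloisRestrict F E).range : Subgroup (absoluteGaloisGroup F)) ⊔ (τ.ker ⊓ C) = ⊤ := by
  obtain ⟨V, hV, hV'⟩ := exists_finset_forall_splitPrimes_fixingSubgroup_sup_eq_top τ hτ C hC S hS
  refine ⟨V, hV, fun E _ _ _ hE => ?_⟩
  -- `res(Γ_E) = Gal(F̄/E')` for the copy `E' = e(E) ⊆ F̄` of `E`
  obtain ⟨e, he⟩ := exists_mem_range_absGaloisRestrict_iff F E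
  set E' : IntermediateField F (AlgebraicClosure F) := e.fieldRange with hE'
  have eE : E ≃ₐ[F] E' := e.equivFieldRange
  have hrange : ((absGaloisRestrict F E).range : Subgroup (absoluteGaloisGroup F)) =
      (E'.fixingSubgroup : Subgroup (absoluteGaloisGroup F)) := by
    ext g
    refine (he g).trans (Iff.trans ?_ (mem_fixingSubgroup_iff_forall_smul E' g).symm)
    constructor
    · rintro h ⟨x, ⟨k, rfl⟩⟩
      exact h k
    · intro h k
      exact h ⟨e k, ⟨k, rfl⟩⟩
  haveI : FiniteDimensional F E' := LinearEquiv.finiteDimensional eE.toLinearEquiv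
  haveI : NumberField E' := NumberField.of_module_finite F E'
  have hE'split : ∀ q ∈ V, q ∈ splitPrimes F E' := fun q hq => by
    rw [← splitPrimes_congr eE]
    exact hE q hq
  rw [hrange]
  exact hV' E' inferInstance hE'split

/-- **Transfer of the residual hypotheses (3)–(4) of ACC+ Thm. 6.1.1 to a `V`-split extension**,
in the vocabulary of the tree's statement of the theorem
(`Automorphic/ACCAutomorphyLiftingCrystalline.lean`).  Let `τ = ρ̄ : Γ_F → GL_n(k)` have open
kernel, `p` a prime, `S` finite.  There is a finite set `V` of finite places of `F` outside `S`,
of prime absolute norm, with `ρ̄(I_𝔓) = 1` and `I_𝔓 ≤ Γ_{F(ζ_p)}` above `V`, such that for every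
finite extension `E/F` (an `F`-algebra; Galois or not) in which all places of `V` split
completely, with `res : Γ_E → Γ_F` the restriction and `ρ̄|_{Γ_E} = ρ̄ ∘ res`:
**(a)** `ρ̄(Γ_E) = ρ̄(Γ_F)`; **(b)** `ρ̄(Γ_{E(ζ_p)}) = ρ̄(Γ_{F(ζ_p)})`
(`Γ_{E(ζ_p)} = res⁻¹(Γ_{F(ζ_p)})`); **(c)** for every `σ ∈ Γ_F` there is `σ' ∈ Γ_E` with
`ρ̄(res σ') = ρ̄(σ)` and `σ' ∈ Γ_{E(ζ_p)} ↔ σ ∈ Γ_{F(ζ_p)}` — so a scalar `ρ̄(σ)` with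
`σ ∉ Γ_{F(ζ_p)}` (hypothesis (4)) yields a scalar `ρ̄(res σ')` with `σ' ∉ Γ_{E(ζ_p)}`.  Printed:
"`ρ̄(G_E) = ρ̄(G_F)` and `ρ̄(G_{E(ζ_p)}) = ρ̄(G_{F(ζ_p)})`. In particular, `ρ̄|_{G_{E(ζ_p)}}` has
enormous image and there exists `σ ∈ G_E − G_{E(ζ_p)}` such that `ρ̄(σ)` is a scalar."
[cite: ACCGHLNSTT2023, §6.5.12 (proof of Thm. 6.1.1, p. 88 of arXiv:1812.09999)] -/
theorem exists_finset_forall_splitPrimes_residual_hypotheses_transfer {H : Type*} [Group H]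
    (τ : absoluteGaloisGroup F →* H) (hτ : IsOpen (τ.ker : Set (absoluteGaloisGroup F)))
    (p : ℕ) [Fact p.Prime] (S : Set (HeightOneSpectrum (𝓞 F))) (hS : S.Finite) :
    ∃ V : Finset (HeightOneSpectrum (𝓞 F)),
      (∀ q ∈ V, q ∉ S ∧ (Ideal.absNorm q.asIdeal).Prime ∧
        ∀ 𝔓 ∈ q.primesAbove, ∀ γ ∈ 𝔓.inertia (absoluteGaloisGroup F),
          τ γ = 1 ∧ γ ∈ absGaloisGroupAdjoinRootsOfUnity F p) ∧
      ∀ (E : Type) [Field E] [NumberField E] [Algebra F E],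
        (∀ q ∈ V, q ∈ splitPrimes F E) →
        (τ.comp (absGaloisRestrict F E).toMonoidHom).range = τ.range ∧
        (absGaloisGroupAdjoinRootsOfUnity E p).map (τ.comp (absGaloisRestrict F E).toMonoidHom) =
          (absGaloisGroupAdjoinRootsOfUnity F p).map τ ∧
        ∀ σ : absoluteGaloisGroup F, ∃ σ' : absoluteGaloisGroup E,
          τ (absGaloisRestrict F E σ') = τ σ ∧
            (σ' ∈ absGaloisGroupAdjoinRootsOfUnity E p ↔ σ ∈ absGaloisGroupAdjoinRootsOfUnity F p) := by
  have hp : p.Prime := Fact.out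
  haveI := normal_absGaloisGroupAdjoinRootsOfUnity F p
  set CF : Subgroup (absoluteGaloisGroup F) := absGaloisGroupAdjoinRootsOfUnity F p with hCF
  obtain ⟨V, hV, hV'⟩ := exists_finset_forall_splitPrimes_range_absGaloisRestrict_sup_eq_top τ hτ
    CF (isOpen_absGaloisGroupAdjoinRootsOfUnity F p hp.pos) S hS
  refine ⟨V, hV, fun E _ _ _ hE => ?_⟩
  set res := (absGaloisRestrict F E).toMonoidHom with hres
  obtain ⟨key, h1, h2⟩ := forall_exists_mem_of_sup_ker_inf_eq_top τ (hV' E hE)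
  -- `res⁻¹(Γ_{F(ζ_p)}) = Γ_{E(ζ_p)}`
  have hCE : ∀ σ' : absoluteGaloisGroup E,
      σ' ∈ absGaloisGroupAdjoinRootsOfUnity E p ↔ absGaloisRestrict F E σ' ∈ CF := fun σ' =>
    mem_absGaloisGroupAdjoinRootsOfUnity_iff_absGaloisRestrict F E p σ'
  refine ⟨?_, ?_, fun σ => ?_⟩
  · rw [MonoidHom.range_comp]
    exact h1
  · rw [← Subgroup.map_map, ← h2]
    congr 1
    ext g
    constructor
    · rintro ⟨σ', hσ', rfl⟩
      exact ⟨⟨σ', rfl⟩, (hCE σ').mp hσ'⟩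
    · rintro ⟨⟨σ', rfl⟩, hg⟩
      exact ⟨σ', (hCE σ').mpr hg, rfl⟩
  · obtain ⟨e, ⟨σ', rfl⟩, heq, heC⟩ := key σ
    exact ⟨σ', heq, (hCE σ').trans heC⟩

end Abstract

end Literature.NumberTheory.NumberFields

end
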